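import Summits.NavierStokesRegularity.FluidComputer.PalasekTowerHeredityOrBreakdownCeiling
import Summits.NavierStokesRegularity.FluidComputer.PalasekTowerRegisterGlobalFloorsAt

/-!
# REGISTER v2.3′: heredity or breakdown, LEVEL BY LEVEL — the split of `AprioriCeilingAt k` and of `HeredityAt k` (every `k ≥ 1`)

Cell `ns-blowup`, seat `ns-palasek-19250-p2` (g2). Companion of `PalasekTowerHeredityOrBreakdown.lean` (p473253)
and `PalasekTowerHeredityOrBreakdownCeiling.lean` (p473580, the `k ≥ 2` / `HeredityFrom 2` forms), now at a
SINGLE level `k ≥ 1` in the vocabulary of `PalasekTowerRegisterGlobalEnvelopeAt/HalvesAt/FloorsAt.lean`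
(`AprioriCeilingAt k`, `ContinuationEnvelopeAt k`, `ReadoutFloorsAt k`, `SpeedFloorAt k`, `StrainFloorAt k`,
`CoreFloorAt k`) — so that the sibling crux stmt-NavierStokesRegularity-19249 `HeredityAtOne` (skeleton v3:
`stub_apriori_ceiling_at_one`, `stub_speed_floor_at_one`, `stub_strain_floor_at_one`, `stub_core_floor_at_one`)
reads the same way. LABEL: E–C typing (KERNEL glue; no `Prop` is introduced here). WHAT THIS IS NOT: not
Navier–Stokes evidence — nothing is constructed, asserted or decided.

## What is proved (every `k ≥ 1` unless stated)

* `AprioriCeilingAt.noPrematureBreakdownAt` (via `continuationEnvelopeAt_iff_aprioriCeilingAt`, ecbridge-5 and ecbridge-1: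
  given the ceiling, existence to `τ (k+1)` is a theorem), `AprioriCeilingAt.windowCeilingAt` (any `k`);
  **`aprioriCeilingAt_iff_noPrematureBreakdown_and_windowCeiling : AprioriCeilingAt k ↔
  NoPrematureBreakdownAt k ∧ WindowCeilingAt k`** — the registered upper stub of 19249 (`k = 1`) is the clause
  «no registered level-`k` design dies inside window `k`» (whose failure IS (C),
  `navierStokesBreakdownR3_of_not_noPrematureBreakdownAt`) times the window ceiling of the survivors.
* **`heredityOrBreakdownAt_iff_windowCeiling_and_readoutFloorsAt : HeredityOrBreakdownAt k ↔ WindowCeilingAt k ∧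
  ReadoutFloorsAt k`** (any `k`) and the three-floor form `… ↔ WindowCeilingAt k ∧ SpeedFloorAt k ∧ StrainFloorAt k ∧
  CoreFloorAt k`; `heredityAt_iff_noPrematureBreakdown_windowCeiling_readoutFloorsAt`.
* `navierStokesBreakdownR3_of_base_orBreakdownAt_one_heredityFrom_two : EpisodeBaseG → HeredityOrBreakdownAt 1 →
  HeredityFrom 2 → NavierStokesBreakdownR3` (binder 2 alone weakened).

References: S. Palasek, arXiv:2605.13827 §4 [cite: Palasek2026ElementaryModel, §4]; H. Sohr, *The Navier–Stokes
Equations*, Birkhäuser 2001, Ch. V Thm. 1.5.1 [cite: Sohr2001, Ch. V Thm. 1.5.1]; J. C. Robinson, J. L. Rodrigo,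
W. Sadowski, CUP 2016, Thm. 8.17 [cite: RobinsonRodrigoSadowski2016, Thm. 8.17].
-/

noncomputable section

namespace Summit.NavierStokesRegularity.FluidComputer.PalasekTowerClayBridge

open Set MeasureTheory Filter Topology Function
open scoped ENNReal ContDiff NNReal
open Literature.Analysis.FluidPDE
open Summit.NavierStokesRegularity.NavierStokesRegularity

/-! ## §1 The split of the a-priori ceiling at level `k` -/

/-- **The a-priori ceiling at level `k ≥ 1` contains «no premature breakdown»**: given the ceiling, the
stage's flow continues classically with finite energy to `τ (k+1)` (`continuationEnvelopeAt_iff_aprioriCeilingAt`),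
which is a life of the design. [cite: RobinsonRodrigoSadowski2016, Thm. 8.17] -/
theorem AprioriCeilingAt.noPrematureBreakdownAt {k : ℕ} (hk : 1 ≤ k) (h : AprioriCeilingAt k) :
    NoPrematureBreakdownAt k := by
  rintro S hP hR hQ ⟨s⟩
  obtain ⟨u, p, hcl, hagree, hE, -⟩ := (continuationEnvelopeAt_iff_aprioriCeilingAt hk).2 h S hP hR hQ s
  exact ⟨u, p, hcl, ((hagree 0 ⟨le_rfl, (S.τ_pos k).le⟩).1).trans s.initial, hE⟩

/-- The a-priori ceiling at level `k` yields the window ceiling at level `k` (re-gauge the survivor's pressure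
to the stage's, then read the ceiling at `T' = τ (k+1)`). [cite: Sohr2001, Ch. V Thm. 1.5.1] -/
theorem AprioriCeilingAt.windowCeilingAt {k : ℕ} (h : AprioriCeilingAt k) : WindowCeilingAt k := by
  intro S hP hR hQ s v q hcl hv0 hE t ht x
  have hτle : S.τ k ≤ S.τ (k + 1) := S.τ_mono (Nat.le_succ k)
  have hvel : ∀ t ∈ Icc 0 (S.τ k), v t = s.u t := s.velocity_eq_of_classical one_pos hτle hcl hv0 hE
  obtain ⟨P, hclP, hagree⟩ := s.exists_pressure_regauge hτle hcl hvel
  exact h S hP hR hQ s (S.τ (k + 1)) ⟨hτle, le_rfl⟩ v P hclP hagree hE t ⟨(S.τ_pos k).le.trans ht.1, ht.2⟩ x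

/-- **`AprioriCeilingAt k ↔ NoPrematureBreakdownAt k ∧ WindowCeilingAt k`** for every `k ≥ 1` — at `k = 1` the
registered upper stub of 19249 splits into the clause (C)-if-false and the window ceiling of the surviving
level-1 flows. (←): a partial continuation coincides with the surviving datum flow on its slab (forced
Serrin–Masuda, the survivor being bounded by the stage ceiling before `τ k` and by the window ceiling after).
[cite: Sohr2001, Ch. V Thm. 1.5.1] -/
theorem aprioriCeilingAt_iff_noPrematureBreakdown_and_windowCeiling {k : ℕ} (hk : 1 ≤ k) :
    AprioriCeilingAt k ↔ NoPrematureBreakdownAt k ∧ WindowCeilingAt k := by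
  refine ⟨fun h => ⟨h.noPrematureBreakdownAt hk, h.windowCeilingAt⟩, fun ⟨hN, hW⟩ => ?_⟩
  intro S hP hR hQ s T' hT' u p hcl hagree hE t ht x
  have hτk : 0 < S.τ k := S.τ_pos k
  have hτle : S.τ k ≤ S.τ (k + 1) := S.τ_mono (Nat.le_succ k)
  have hT'0 : 0 < T' := hτk.trans_le hT'.1
  obtain ⟨v, q, hclv, hv0, hEv⟩ := hN S hP hR hQ ⟨s⟩
  have hvel : ∀ t ∈ Icc 0 (S.τ k), v t = s.u t := s.velocity_eq_of_classical one_pos hτle hclv hv0 hEv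
  have hB : ∀ t ∈ Icc 0 (S.τ (k + 1)), ∀ x, ‖v t x‖ ≤ S.c₂ * TowerRates.wide.Y (k + 1) := by
    intro t ht x
    rcases le_or_gt t (S.τ k) with htk | htk
    · rw [hvel t ⟨ht.1, htk⟩]
      exact (s.ceiling k le_rfl t ⟨ht.1, htk⟩ x).trans
        (mul_le_mul_of_nonneg_left (TowerRates.wide.Y_le_Y_succ k) s.c₂_pos.le)
    · exact hW S hP hR hQ s v q hclv hv0 hEv t ⟨htk.le, ht.2⟩ x
  have hclv' : IsClassicalNSSolutionOn (Icc 0 T') 1 S.f v q :=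
    hclv.mono (Icc_subset_Icc le_rfl hT'.2) (uniqueDiffOn_Icc hT'0)
  have hEv' : ∃ C : ℝ≥0∞, C < ⊤ ∧ ∀ t ∈ Icc 0 T', ∫⁻ x, ‖v t x‖ₑ ^ 2 ≤ C := by
    obtain ⟨C, hC, hb⟩ := hEv
    exact ⟨C, hC, fun t ht => hb t ⟨ht.1, ht.2.trans hT'.2⟩⟩
  have h0 : u 0 = v 0 := by rw [(hagree 0 ⟨le_rfl, hτk.le⟩).1, s.initial, hv0]
  have huv : ∀ t ∈ Icc 0 T', u t = v t :=
    velocity_eq_of_bounded_classical one_pos hT'0 S.force_smooth S.force_decay hclv' hEv'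
      (fun t ht => hB t ⟨ht.1, ht.2.trans hT'.2⟩) hcl hE h0
  rw [huv t ht]
  exact hB t ⟨ht.1, ht.2.trans hT'.2⟩ x

/-! ## §2 The weak heredity at level `k` in the register's halves -/

/-- The weak heredity at level `k` yields the readout floors at level `k` (the continued flow IS the extension's
velocity; its floors at `τ (k+1)` are the extension's). [cite: Sohr2001, Ch. V Thm. 1.5.1] -/
theorem HeredityOrBreakdownAt.readoutFloorsAt {k : ℕ} (h : HeredityOrBreakdownAt k) : ReadoutFloorsAt k := by
  intro S hP hR hQ s u p hcl hagree hE _hceil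
  have hu0 : u 0 = S.u₀ := ((hagree 0 ⟨le_rfl, (S.τ_pos k).le⟩).1).trans s.initial
  rcases h S hP hR hQ s with hdead | ⟨s', -⟩
  · exact absurd ⟨u, p, hcl, hu0, hE⟩ hdead
  · have hτ : S.τ (k + 1) ∈ Icc 0 (S.τ (k + 1)) := ⟨(S.τ_pos (k + 1)).le, le_rfl⟩
    rw [s'.velocity_eq_of_classical one_pos le_rfl hcl hu0 hE _ hτ]
    exact ⟨s'.floor (k + 1) le_rfl, s'.routeG_strain (k + 1) le_rfl, s'.routeG_coreLedger (k + 1) le_rfl⟩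

/-- **`HeredityOrBreakdownAt k ↔ WindowCeilingAt k ∧ ReadoutFloorsAt k`** (any `k`): the weak heredity keeps the
register's lower half at level `k` verbatim and replaces `AprioriCeilingAt k` by the window ceiling. (←): the
survivor's flow, re-gauged to the stage's pressure (`Stage.exists_pressure_regauge`), stays inside the ceiling
(stage ceiling before `τ k`, window ceiling after), shows the floors by `ReadoutFloorsAt k`, and
`Stage.exists_extends_of_continuation` assembles the level-`k+1` stage. [cite: Palasek2026ElementaryModel, §4] -/
theorem heredityOrBreakdownAt_iff_windowCeiling_and_readoutFloorsAt (k : ℕ) :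
    HeredityOrBreakdownAt k ↔ WindowCeilingAt k ∧ ReadoutFloorsAt k := by
  refine ⟨fun h => ⟨h.windowCeilingAt, h.readoutFloorsAt⟩, fun ⟨hW, hF⟩ S hP hR hQ s => ?_⟩
  by_cases hlive : S.LivesTo 1 (S.τ (k + 1))
  · refine Or.inr ?_
    obtain ⟨v, q, hcl, hv0, hE⟩ := hlive
    have hτle : S.τ k ≤ S.τ (k + 1) := S.τ_mono (Nat.le_succ k)
    have hvel : ∀ t ∈ Icc 0 (S.τ k), v t = s.u t := s.velocity_eq_of_classical one_pos hτle hcl hv0 hE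
    obtain ⟨P, hclP, hagree⟩ := s.exists_pressure_regauge hτle hcl hvel
    have hceil : ∀ t ∈ Icc 0 (S.τ (k + 1)), ∀ x, ‖v t x‖ ≤ S.c₂ * TowerRates.wide.Y (k + 1) := by
      intro t ht x
      rcases le_or_gt t (S.τ k) with htk | htk
      · rw [hvel t ⟨ht.1, htk⟩]
        exact (s.ceiling k le_rfl t ⟨ht.1, htk⟩ x).trans
          (mul_le_mul_of_nonneg_left (TowerRates.wide.Y_le_Y_succ k) s.c₂_pos.le)
      · exact hW S hP hR hQ s v q hcl hv0 hE t ⟨htk.le, ht.2⟩ x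
    obtain ⟨hfloor, hstrain, hcore⟩ := hF S hP hR hQ s v P hclP hagree hE hceil
    exact s.exists_extends_of_continuation hR hclP hagree hE hceil hfloor hstrain hcore
  · exact Or.inl hlive

/-- The three-floor form: `HeredityOrBreakdownAt k ↔ WindowCeilingAt k ∧ SpeedFloorAt k ∧ StrainFloorAt k ∧
CoreFloorAt k` (`readoutFloorsAt_iff_floors`). [folklore] -/
theorem heredityOrBreakdownAt_iff_windowCeiling_floors3 (k : ℕ) :
    HeredityOrBreakdownAt k ↔ WindowCeilingAt k ∧ SpeedFloorAt k ∧ StrainFloorAt k ∧ CoreFloorAt k := by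
  rw [heredityOrBreakdownAt_iff_windowCeiling_and_readoutFloorsAt, readoutFloorsAt_iff_floors]

/-- **The register's heredity at level `k ≥ 1` as clause × window ceiling × floors**:
`HeredityAt k ↔ NoPrematureBreakdownAt k ∧ WindowCeilingAt k ∧ ReadoutFloorsAt k`. [folklore] -/
theorem heredityAt_iff_noPrematureBreakdown_windowCeiling_readoutFloorsAt (k : ℕ) :
    HeredityAt k ↔ NoPrematureBreakdownAt k ∧ WindowCeilingAt k ∧ ReadoutFloorsAt k := by
  rw [heredityAt_iff_orBreakdown_and_noPrematureBreakdown, heredityOrBreakdownAt_iff_windowCeiling_and_readoutFloorsAt]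
  exact ⟨fun ⟨⟨hW, hF⟩, hN⟩ => ⟨hN, hW, hF⟩, fun ⟨hN, hW, hF⟩ => ⟨⟨hW, hF⟩, hN⟩⟩

/-- At the first rung: `HeredityAtOne ↔ NoPrematureBreakdownAt 1 ∧ WindowCeilingAt 1 ∧ SpeedFloorAt 1 ∧ StrainFloorAt 1 ∧
CoreFloorAt 1` — the five conjuncts matching 19249's skeleton v3 plus the clause. [folklore] -/
theorem heredityAtOne_iff_noPrematureBreakdown_windowCeiling_floors3 :
    HeredityAtOne ↔ NoPrematureBreakdownAt 1 ∧ WindowCeilingAt 1 ∧ SpeedFloorAt 1 ∧ StrainFloorAt 1 ∧ CoreFloorAt 1 := by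
  rw [heredityAtOne_iff, heredityAt_iff_noPrematureBreakdown_windowCeiling_readoutFloorsAt,
    readoutFloorsAt_iff_floors]

/-! ## §3 The closer with the first binder alone weakened -/

/-- **`EpisodeBaseG → HeredityOrBreakdownAt 1 → HeredityFrom 2 → NavierStokesBreakdownR3`** — the route's deciding
theorem with binder 2 (the first rung) weakened to its or-breakdown form. [cite: FeffermanClay2006, (C)] -/
theorem navierStokesBreakdownR3_of_base_orBreakdownAt_one_heredityFrom_two (h₁ : EpisodeBaseG)
    (h₂ : HeredityOrBreakdownAt 1) (h₃ : HeredityFrom 2) :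
    Summit.NavierStokesRegularity.NavierStokesRegularity.NavierStokesBreakdownR3 :=
  navierStokesBreakdownR3_of_base_orBreakdownAt_one_orBreakdownFrom_two h₁ h₂ h₃.orBreakdown

end Summit.NavierStokesRegularity.FluidComputer.PalasekTowerClayBridge

end
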